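import Literature.Analysis.FluidPDE.FiniteFourierModeEulerPlanarEigen
import Literature.Analysis.FluidPDE.FiniteFourierModeEulerPlanarLinAlg

/-!
# Kishimoto–Yoneda §3 (planar case): stationarity of planar-supported solutions

Support file for `FiniteFourierModeEuler` (N. Kishimoto, T. Yoneda, J. Math. Fluid Mech. 24
(2022) 74 = arXiv:2110.08039), §3: a finite-mode Euler solution on a generic interval (all modes
occupied, horizontal parts mode-wise identically zero or never zero) whose support lies in a plane
through the origin is independent of time (`IsFiniteModeEulerSolution.planar_stationary`).

First part (Prop. 3.1, the spanning case): the skew-Hermitian operator `B` of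
`FiniteFourierModeEulerPlanarLinAlg` restricted to the span `W` of the vertical trajectory has an
orthonormal eigenbasis (spectral theorem for the Hermitian `iB|_W`); each eigenvector extends by
zero to a finitely supported eigenvector of the transport `A`, so by Lemma 3.3
(`PolyCfg.no_eigenvector`) all eigenvalues vanish, `B|_W = 0`, `∂_t u^⊥_n = 0`; together with
Prop. 3.1 (i) (`hcoef_const`) every coefficient `u_n` is constant on `I` (`PlanarCfg.u_const`).

Second part (the cases): `S_∥` spans the plane — Prop. 3.1 (`PlanarCfg.u_const`); `S_∥`
contained in a line `ℓ` — then all of `S` lies on `ℓ` ("Suppose for contradiction that it is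
contained in a line `ℓ` … Lemma 2.1 implies that the vertical component … is nonzero, which is a
contradiction"), and collinear modes do not interact at all (case (i) of Thm. 1.4); `S_∥ = ∅`
(`u ⊥ P`) — no interaction either.

## References

* [KishimotoYoneda2022] N. Kishimoto, T. Yoneda, J. Math. Fluid Mech. 24 (2022) 74 =
  arXiv:2110.08039, §3 Prop. 3.1 and its proof (Lemmas 3.2, 3.3; "`S_∥` has two linearly
  independent vectors"); Thm. 1.4 (i).
-/

noncomputable section

open Matrix Finset Complex

namespace Literature.Analysis.FluidPDE

namespace KY

open scoped Classical

section SpanningCase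

open scoped InnerProductSpace ComplexConjugate

namespace PlanarCfg

variable {I : Set ℝ} {S : Finset (Fin 3 → ℝ)} {u : (Fin 3 → ℝ) → ℝ → (Fin 3 → ℂ)}
  {e : Fin 3 → ℝ} {S_h : Finset (Fin 3 → ℝ)} (P : PlanarCfg I S u e S_h)
  (hspan : ∃ a ∈ S_h, ∃ b ∈ S_h, pc e a b ≠ 0) {t₀ : ℝ} (ht₀ : t₀ ∈ I)
include P hspan ht₀

/-! ### The transport `A` on `S`-supported functions is the compression `B` -/

omit hspan in
/-- `A = B` on functions supported in `S` (the coefficients `α₀` vanish off `S_h`). [folklore] -/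
theorem convOp_eq_planarOp (φ : (Fin 3 → ℝ) → ℂ) (hφ : ∀ n ∉ S, φ n = 0) (n : Fin 3 → ℝ) :
    convOp S_h e (α₀ e u t₀) φ n = planarOp S e (α₀ e u t₀) φ n := by
  rw [planarOp_eq_sum]
  unfold convOp
  congr 1
  -- enlarge the index set from `S_h` to `S`
  have h1 : ∑ m ∈ S_h, ((pc e m (n - m) : ℝ) : ℂ) * α₀ e u t₀ m * φ (n - m)
      = ∑ m ∈ S, ((pc e m (n - m) : ℝ) : ℂ) * α₀ e u t₀ m * φ (n - m) := by
    apply Finset.sum_subset P.sub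
    intro m hm hmh
    rw [show α₀ e u t₀ m = 0 from P.hoff m hm hmh t₀ ht₀, mul_zero, zero_mul]
  rw [h1]
  -- insert the vanishing condition and reindex `m ↦ n - m`
  have h2 : ∑ m ∈ S, ((pc e m (n - m) : ℝ) : ℂ) * α₀ e u t₀ m * φ (n - m)
      = ∑ m ∈ S, (if n - m ∈ S then ((pc e m (n - m) : ℝ) : ℂ) * α₀ e u t₀ m * φ (n - m) else 0) := by
    refine Finset.sum_congr rfl fun m _ => ?_
    split_ifs with h
    · rfl
    · rw [hφ _ h, mul_zero]
  rw [h2, ← Finset.sum_filter, ← Finset.sum_filter]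
  apply Finset.sum_nbij' (fun m => n - m) (fun m => n - m)
  · intro m hm
    simp only [Finset.mem_filter] at hm ⊢
    exact ⟨hm.2, by simpa only [_root_.sub_sub_cancel] using hm.1⟩
  · intro m hm
    simp only [Finset.mem_filter] at hm ⊢
    exact ⟨hm.2, by simpa only [_root_.sub_sub_cancel] using hm.1⟩
  · intro m _; exact _root_.sub_sub_cancel n m
  · intro m _; exact _root_.sub_sub_cancel n m
  · intro m _; simp only [_root_.sub_sub_cancel]

/-! ### Eigenvectors of `iB|_W` and the vanishing of `B|_W` -/

/-- **An eigenvector of `B` in `W` extends to an eigenvector of the transport; hence its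
eigenvalue vanishes** (Lemma 3.3). [cite: KishimotoYoneda2022, §3 Lemma 3.3] -/
theorem eigen_zero {x : Esp S} (hx : x ∈ Wsp I S e u) (hx0 : x ≠ 0) {θ : ℂ}
    (heig : Bop S e u t₀ x = θ • x) : θ = 0 := by
  by_contra hθ
  have Q := P.polyCfg hspan
  have hφS : ∀ n ∉ S, ext x n = 0 := fun n hn => ext_apply_notMem x hn
  have hall : ∀ n, convOp S_h e (α₀ e u t₀) (ext x) n = θ * ext x n := by
    intro n
    rw [P.convOp_eq_planarOp ht₀ (ext x) hφS n]
    by_cases hn : n ∈ S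
    · have := congrArg (fun y : Esp S => y ⟨n, hn⟩) heig
      simp only [PiLp.smul_apply, smul_eq_mul] at this
      rw [← Bop_eq_planarOp (y := x) (n := ⟨n, hn⟩), ext_apply_mem x hn]
      exact this
    · rw [P.constraint_W hspan ht₀ hx hn, hφS n hn, mul_zero]
  have hzero := Q.no_eigenvector (α := α₀ e u t₀) (fun n hn => P.hon n hn t₀ ht₀)
    (fun j n hn h1 => P.eq_V_of_fE_eq_one hspan j hn h1) (fun s hs hne => Q.gV_lt_one 0 hs hne)
    (F := S) (fun n hn => by by_contra h; exact hn (hφS n h)) P.sol.zero_notMem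
    (fun n hn => by
      have hnS : n ∈ S := by by_contra h; exact hn (hφS n h)
      exact P.plane n hnS) hθ hall
  apply hx0
  ext n
  have := hzero n.1
  rw [ext_apply_mem x n.2] at this
  simpa using this

/-- **`B` vanishes on the trajectory**: `B w(t) = 0`. [cite: KishimotoYoneda2022, §3 Prop. 3.1 (ii) ("`u^⊥` is independent of `t`")] -/
theorem Bop_wv_eq_zero {t : ℝ} (ht : t ∈ I) : Bop S e u t₀ (res (S := S) (wv e u t)) = 0 := by
  set K := Wsp I S e u with hK
  have hmaps := P.Bop_maps hspan ht₀
  set BK : K →ₗ[ℂ] K := (Bop S e u t₀).restrict hmaps with hBK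
  set T : K →ₗ[ℂ] K := Complex.I • BK with hT
  have hTsymm : LinearMap.IsSymmetric (𝕜 := ℂ) (E := K) T := by
    intro a b
    simp only [hT, hBK, LinearMap.smul_apply, Submodule.coe_inner, Submodule.coe_smul,
      LinearMap.coe_restrict_apply, inner_smul_left, inner_smul_right, Complex.conj_I, P.Bop_skew]
    ring
  set b := hTsymm.eigenvectorBasis rfl with hb
  -- every eigenvalue vanishes
  have hμ : ∀ i, hTsymm.eigenvalues rfl i = 0 := by
    intro i
    have happ := hTsymm.apply_eigenvectorBasis rfl i
    rw [← hb] at happ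
    -- `B (b i) = (-I μ) • (b i)` in `Esp S`
    have hB : Bop S e u t₀ (b i : Esp S) = (-Complex.I * (hTsymm.eigenvalues rfl i : ℂ)) • (b i : Esp S) := by
      have h1 : (T (b i) : Esp S) = Complex.I • Bop S e u t₀ (b i : Esp S) := by
        simp only [hT, hBK, LinearMap.smul_apply, Submodule.coe_smul, LinearMap.coe_restrict_apply]
      have h2 : (T (b i) : Esp S) = ((hTsymm.eigenvalues rfl i : ℝ) : ℂ) • (b i : Esp S) := by
        rw [happ, Submodule.coe_smul]; rfl
      have h3 : Bop S e u t₀ (b i : Esp S) = (-Complex.I) • (T (b i) : Esp S) := by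
        rw [h1, smul_smul]; simp
      rw [h3, h2, smul_smul]
    have hne : (b i : Esp S) ≠ 0 := by
      intro h0
      have := b.orthonormal.1 i
      rw [show ‖b i‖ = ‖(b i : Esp S)‖ from rfl, h0, norm_zero] at this
      exact zero_ne_one this
    have hz := P.eigen_zero hspan ht₀ (b i).2 hne hB
    have : (hTsymm.eigenvalues rfl i : ℂ) = 0 := by
      have := mul_eq_zero.1 hz
      exact this.resolve_left (neg_ne_zero.2 Complex.I_ne_zero)
    exact_mod_cast this
  -- hence `T = 0` on `K`, so `B w(t) = 0`
  have hT0 : ∀ v : K, T v = 0 := by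
    intro v
    rw [← b.sum_repr v, map_sum]
    apply Finset.sum_eq_zero
    intro i _
    have happ := hTsymm.apply_eigenvectorBasis rfl i
    rw [← hb, hμ i] at happ
    rw [map_smul, happ]
    simp
  have hv : T ⟨res (wv e u t), res_wv_mem ht⟩ = 0 := hT0 _
  have : (T ⟨res (wv e u t), res_wv_mem ht⟩ : Esp S) = Complex.I • Bop S e u t₀ (res (wv e u t)) := by
    simp only [hT, hBK, LinearMap.smul_apply, Submodule.coe_smul, LinearMap.coe_restrict_apply]
  rw [hv, Submodule.coe_zero] at this
  exact (smul_eq_zero.1 this.symm).resolve_left Complex.I_ne_zero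

/-- **Prop. 3.1 (ii): the vertical coefficients are independent of time.** [cite: KishimotoYoneda2022, §3 Prop. 3.1 (ii)] -/
theorem vert_const (n : Fin 3 → ℝ) {t s : ℝ} (ht : t ∈ I) (hs : s ∈ I) : vert e (u n t) = vert e (u n s) := by
  by_cases hn : n ∈ S
  · apply P.sol.isOpen.is_const_of_deriv_eq_zero P.sol.ordConnected.isPreconnected (P.differentiableOn_vert n)
      _ ht hs
    intro r hr
    show deriv (fun s => vert e (u n s)) r = 0
    have h1 := P.deriv_wv hspan ht₀ n hr
    have h2 := Bop_eq_planarOp (e := e) (u := u) (t₀ := t₀) (res (S := S) (wv e u r)) ⟨n, hn⟩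
    rw [P.ext_res_wv, P.Bop_wv_eq_zero hspan ht₀ hr] at h2
    have h3 : planarOp S e (α₀ e u t₀) (wv e u r) n = 0 := by rw [← h2]; rfl
    have h4 : (fun s => vert e (u n s)) = fun s => wv e u s n := rfl
    rw [h4, h1, h3, neg_zero]
  · rw [P.sol.eq_zero_of_notMem n hn t, P.sol.eq_zero_of_notMem n hn s]

/-- **Prop. 3.1, stationarity (spanning case): every coefficient `u_n` is constant on `I`.**
[cite: KishimotoYoneda2022, §3 Prop. 3.1 ("Then, `u` is independent of `t`")] -/
theorem u_const (n : Fin 3 → ℝ) {t s : ℝ} (ht : t ∈ I) (hs : s ∈ I) : u n t = u n s := by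
  by_cases hn : n ∈ S
  · rw [P.decomp_mem hn ht, P.decomp_mem hn hs, P.hcoef_const hspan n ht hs, P.vert_const hspan ht₀ n ht hs]
  · rw [P.sol.eq_zero_of_notMem n hn t, P.sol.eq_zero_of_notMem n hn s]

end PlanarCfg

end SpanningCase

namespace PlanarCfg

variable {I : Set ℝ} {S : Finset (Fin 3 → ℝ)} {u : (Fin 3 → ℝ) → ℝ → (Fin 3 → ℂ)}
  {e : Fin 3 → ℝ} {S_h : Finset (Fin 3 → ℝ)} (P : PlanarCfg I S u e S_h)
include P

/-! ### No interaction when all pairs are collinear or vertical -/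

/-- A pair bracket vanishes when the frequencies are parallel or both modes are vertical.
[cite: KishimotoYoneda2022, §3 ("the second term on the left-hand side of (cond:parallel) vanishes")] -/
theorem bracket_eq_zero {a b : Fin 3 → ℝ} (ha : a ∈ S) (hb : b ∈ S) {t : ℝ} (ht : t ∈ I)
    (h : pc e a b = 0 ∨ (hcoef e a (u a t) = 0 ∧ hcoef e b (u b t) = 0)) :
    bracket a b (u a t) (u b t) = 0 := by
  rw [bracket_planar (P.plane a ha) (P.plane b hb) (P.decomp_mem ha ht) (P.decomp_mem hb ht)]
  rcases h with h | ⟨h1, h2⟩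
  · rw [h]; simp
  · rw [h1, h2, zero_smul, zero_smul, sub_self, smul_zero]

/-- **Stationarity without interaction.** If every pair of occupied frequencies is parallel or
consists of two vertical modes, the solution is independent of time. [cite: KishimotoYoneda2022, Thm. 1.4 (i) and §3] -/
theorem stationary_of_trivial
    (h : ∀ a ∈ S, ∀ b ∈ S, ∀ t ∈ I, pc e a b = 0 ∨ (hcoef e a (u a t) = 0 ∧ hcoef e b (u b t) = 0))
    (n : Fin 3 → ℝ) {t s : ℝ} (ht : t ∈ I) (hs : s ∈ I) : u n t = u n s := by
  apply P.sol.eq_of_deriv_eq_zero n _ ht hs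
  intro r hr i
  by_cases hn : n ∈ S
  · rw [P.sol.deriv_eq (P.sol.ne_zero_of_mem hn) hr, nonlin_eq_sum_bracket, Finset.sum_eq_zero, proj_zero,
      smul_zero, Pi.zero_apply, neg_zero]
    rintro ⟨a, b⟩ hq
    simp only [Finset.mem_filter, Finset.mem_product] at hq
    exact P.bracket_eq_zero hq.1.1 hq.1.2 hr (h a hq.1.1 b hq.1.2 r hr)
  · exact P.sol.deriv_eq_zero_of_notMem hn r i

/-! ### `S_∥` in a line forces `S` into that line -/

/-- Planar vectors with `τ(a, s) = 0`, `a ≠ 0`, are parallel: `s = r a`. [folklore] -/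
theorem exists_smul_of_pc_eq_zero {a s : Fin 3 → ℝ} (ha0 : a ≠ 0) (ha : e ⬝ᵥ a = 0) (hs : e ⬝ᵥ s = 0)
    (h : pc e a s = 0) : ∃ r : ℝ, s = r • a := by
  have hcr : a ⨯₃ s = 0 := by rw [cross_planar P.he ha hs, h, zero_div, zero_smul]
  exact ⟨_, eq_smul_of_cross_eq_zero ha0 (by rw [← cross_anticomm, hcr, neg_zero])⟩

/-- **If `S_∥ ≠ ∅` is contained in a line, so is `S`** (at a time at which all modes are occupied).
[cite: KishimotoYoneda2022, §3 proof of Prop. 3.1 (i) ("`S_∥` has two linearly independent vectors" — the contradiction argument)] -/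
theorem collinear_of_collinear_h (hgen : ∀ n ∈ S, ∀ t ∈ I, u n t ≠ 0)
    (hcol : ∀ a ∈ S_h, ∀ b ∈ S_h, pc e a b = 0) {n₁ : Fin 3 → ℝ} (hn₁ : n₁ ∈ S_h)
    (hfar : ∀ s ∈ S_h, s ⬝ᵥ s ≤ n₁ ⬝ᵥ n₁) : ∀ s ∈ S, pc e n₁ s = 0 := by
  by_contra hno
  push Not at hno
  -- the off-line points and the maximiser `n₂` of `n · n₁`
  set L := S.filter fun s => pc e n₁ s ≠ 0 with hL
  have hLne : L.Nonempty := by obtain ⟨s, hs, h⟩ := hno; exact ⟨s, Finset.mem_filter.2 ⟨hs, h⟩⟩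
  obtain ⟨n₂, hn₂L, hn₂max⟩ := L.exists_max_image (fun s => s ⬝ᵥ n₁) hLne
  obtain ⟨hn₂, hpc₂⟩ := Finset.mem_filter.1 hn₂L
  have hn₁S : n₁ ∈ S := P.sub hn₁
  have hn₁0 : n₁ ≠ 0 := P.sol.ne_zero_of_mem hn₁S
  have hn₂h : n₂ ∉ S_h := fun h => hpc₂ (hcol n₁ hn₁ n₂ h)
  obtain ⟨t, ht⟩ := P.sol.nonempty
  have hα₂ : hcoef e n₂ (u n₂ t) = 0 := P.hoff n₂ hn₂ hn₂h t ht
  -- `m = n₁ + n₂ ∉ S`, `m ≠ 0`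
  have hm0 : n₁ + n₂ ≠ 0 := by
    intro h0
    apply hpc₂
    rw [show n₂ = -n₁ from eq_neg_of_add_eq_zero_right h0, pc_neg_right, pc_self, neg_zero]
  have hρ : 0 < n₁ ⬝ᵥ n₁ := lt_of_le_of_ne
    (by rw [real_dot_eq]; nlinarith [sq_nonneg (n₁ 0), sq_nonneg (n₁ 1), sq_nonneg (n₁ 2)])
    (Ne.symm (real_dot_self_ne_zero hn₁0))
  have hmS : n₁ + n₂ ∉ S := by
    intro hm
    have hmL : n₁ + n₂ ∈ L := Finset.mem_filter.2 ⟨hm, by rw [pc_add_right, pc_self, zero_add]; exact hpc₂⟩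
    have := hn₂max _ hmL
    rw [add_dotProduct] at this
    linarith
  -- the other pairs vanish
  have hothers : ∀ c ∈ S, ∀ d ∈ S, c ≠ d → c + d = n₁ + n₂ → ¬ (c = n₁ ∧ d = n₂) → ¬ (c = n₂ ∧ d = n₁) →
      NonInteracting c d (u c t) (u d t) := by
    intro c hc d hd _ hcd h1 h2
    -- both `c` and `d` are vertical (off `S_h`)
    have key : ∀ c ∈ S, ∀ d ∈ S, c + d = n₁ + n₂ → ¬ (c = n₂ ∧ d = n₁) → pc e n₁ c ≠ 0 → d ∉ S_h := by
      intro c hc d hd hcd h2 hpc hdh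
      -- `d ∈ S_h ⊆ ℓ`: `d = r n₁` with `|r| ≤ 1`
      obtain ⟨r, hr⟩ := P.exists_smul_of_pc_eq_zero hn₁0 (P.plane n₁ hn₁S) (P.plane d hd) (hcol n₁ hn₁ d hdh)
      have hrle : r * r ≤ 1 := by
        have := hfar d hdh
        rw [hr, smul_dotProduct, dotProduct_smul, smul_eq_mul, smul_eq_mul] at this
        nlinarith
      have hcL : c ∈ L := Finset.mem_filter.2 ⟨hc, hpc⟩
      have hle := hn₂max c hcL
      have hc' : c = n₂ + (n₁ - d) := by rw [eq_sub_of_add_eq hcd]; abel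
      rw [hc', add_dotProduct, sub_dotProduct, hr, smul_dotProduct, smul_eq_mul] at hle
      -- `|n₁|² - r|n₁|² ≤ 0` forces `r = 1`, i.e. `d = n₁`, `c = n₂`
      have hr1 : r = 1 := by nlinarith
      apply h2
      rw [hr1, one_smul] at hr
      exact ⟨by rw [hc', hr]; abel, hr⟩
    have hcS_h : c ∉ S_h ∨ pc e n₁ c = 0 := by
      by_cases h : pc e n₁ c = 0
      · exact Or.inr h
      · left; intro hch; exact h (hcol n₁ hn₁ c hch)
    -- if `c` is on the line then `d = m - c` is off the line, and symmetric
    by_cases hpc : pc e n₁ c = 0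
    · -- then `pc n₁ d ≠ 0`, so `c ∉ S_h` by `key` with roles swapped
      have hpd : pc e n₁ d ≠ 0 := by
        intro h0
        apply hpc₂
        have : n₂ = c + d - n₁ := by rw [hcd]; abel
        rw [this, pc_sub_right, pc_add_right, hpc, h0, pc_self]; ring
      have hch : c ∉ S_h := key d hd c hc (by rw [add_comm]; exact hcd) (fun h => h1 ⟨h.2, h.1⟩) hpd
      have hdh : d ∉ S_h := fun h => hpd (hcol n₁ hn₁ d h)
      unfold NonInteracting
      rw [P.bracket_eq_zero hc hd ht (Or.inr ⟨P.hoff c hc hch t ht, P.hoff d hd hdh t ht⟩), proj_zero]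
    · have hdh : d ∉ S_h := key c hc d hd hcd h2 hpc
      have hch : c ∉ S_h := fun h => hpc (hcol n₁ hn₁ c h)
      unfold NonInteracting
      rw [P.bracket_eq_zero hc hd ht (Or.inr ⟨P.hoff c hc hch t ht, P.hoff d hd hdh t ht⟩), proj_zero]
  have hne12 : n₁ ≠ n₂ := fun h => hn₂h (h ▸ hn₁)
  have hNI := P.sol.nonInteracting_of_others_vanish hn₁S hn₂ hne12 hmS ht hothers
  -- the vertical component of the bracket of `(n₁, n₂)` is `τ₁₂ α₁ w₂ ≠ 0`
  unfold NonInteracting at hNI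
  have hv := congrArg (vert e) hNI
  rw [vert_proj (by rw [dotProduct_add, P.plane n₁ hn₁S, P.plane n₂ hn₂, add_zero]), vert_zero,
    vert_bracket_planar P.he (P.plane n₁ hn₁S) (P.plane n₂ hn₂) (P.decomp_mem hn₁S ht) (P.decomp_mem hn₂ ht),
    hα₂, zero_mul, sub_zero] at hv
  have hτ : ((pc e n₁ n₂ : ℝ) : ℂ) ≠ 0 := by exact_mod_cast hpc₂
  have hα₁ : hcoef e n₁ (u n₁ t) ≠ 0 := P.hon n₁ hn₁ t ht
  have hw₂ : vert e (u n₂ t) = 0 := by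
    have := mul_eq_zero.1 hv
    rcases this with h | h
    · exact absurd h hτ
    · exact (mul_eq_zero.1 h).resolve_left hα₁
  apply hgen n₂ hn₂ t ht
  rw [P.decomp_mem hn₂ ht, hα₂, hw₂, zero_smul, zero_smul, add_zero]

end PlanarCfg

/-! ### The planar theorem -/

namespace IsFiniteModeEulerSolution

variable {I : Set ℝ} {S : Finset (Fin 3 → ℝ)} {u : (Fin 3 → ℝ) → ℝ → (Fin 3 → ℂ)}

/-- **Kishimoto–Yoneda §3: planar-supported finite-mode Euler flows are stationary.** On a
generic interval (all modes occupied; each horizontal part identically zero or never zero), a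
solution with support in the plane `e^⊥` is independent of time. [cite: KishimotoYoneda2022, §3 Prop. 3.1; Thm. 1.4 (i), (ii)] -/
theorem planar_stationary (hS : IsFiniteModeEulerSolution I S u) (hgen : ∀ n ∈ S, ∀ t ∈ I, u n t ≠ 0)
    {e : Fin 3 → ℝ} (he : e ≠ 0) (hplane : ∀ n ∈ S, e ⬝ᵥ n = 0)
    (hgenh : ∀ n ∈ S, (∀ t ∈ I, hcoef e n (u n t) = 0) ∨ (∀ t ∈ I, hcoef e n (u n t) ≠ 0)) :
    ∀ n, ∀ t ∈ I, ∀ s ∈ I, u n t = u n s := by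
  set S_h := S.filter fun n => ∀ t ∈ I, hcoef e n (u n t) ≠ 0 with hS_h
  have P : PlanarCfg I S u e S_h :=
    { sol := hS, he := he, plane := hplane, sub := Finset.filter_subset _ _,
      hon := fun n hn => (Finset.mem_filter.1 hn).2,
      hoff := fun n hn hnh => by
        rcases hgenh n hn with h | h
        · exact h
        · exact absurd (Finset.mem_filter.2 ⟨hn, h⟩) hnh }
  intro n t ht s hs
  by_cases hspan : ∃ a ∈ S_h, ∃ b ∈ S_h, pc e a b ≠ 0
  · obtain ⟨t₀, ht₀⟩ := hS.nonempty
    exact P.u_const hspan ht₀ n ht hs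
  · push Not at hspan
    apply P.stationary_of_trivial _ n ht hs
    intro a ha b hb r hr
    by_cases hemp : S_h = ∅
    · right
      exact ⟨P.hoff a ha (by rw [hemp]; simp) r hr, P.hoff b hb (by rw [hemp]; simp) r hr⟩
    · left
      obtain ⟨n₁, hn₁, hfar⟩ := S_h.exists_max_image (fun s => s ⬝ᵥ s) (Finset.nonempty_iff_ne_empty.2 hemp)
      have hall := P.collinear_of_collinear_h hgen hspan hn₁ hfar
      have hn₁0 : n₁ ≠ 0 := hS.ne_zero_of_mem (P.sub hn₁)
      obtain ⟨ra, hra⟩ := P.exists_smul_of_pc_eq_zero hn₁0 (hplane n₁ (P.sub hn₁)) (hplane a ha) (hall a ha)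
      obtain ⟨rb, hrb⟩ := P.exists_smul_of_pc_eq_zero hn₁0 (hplane n₁ (P.sub hn₁)) (hplane b hb) (hall b hb)
      rw [hra, hrb, pc_smul_left, pc_smul_right, pc_self, mul_zero, mul_zero]

end IsFiniteModeEulerSolution

end KY

end Literature.Analysis.FluidPDE
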